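import Summits.CriticalPhenomena.PercolationContinuityZ3.Theorems.PercNearOneGluingNoHeavyLowerTailQuantitativeBHKHat
import HarnessLib

/-!
# Quantitative BHK (2/3): BHK's Theorem 1.1 with a forced-opened pair — the induction (TP) and the forced-opening correlation (FO)

Support file (`--supports stmt-CriticalPhenomena-4575`), prover seat `prim-rate-mine-2` (rows M2-R8(a)/(b)).  Part 2 of 3.
`QuantBHK.coreHat`: for `s ∈ U`, `X, Y ⊆ U`, `F, G ≥ 0` increasing,
`E[F(C) 1{s↮X}] · E[G(Ĉ_Y) 1{s↮Y}] ≤ E[F(C) G(Ĉ_{X∩Y}) 1{s↮X∩Y}] · P(s↮X∪Y)` — the tree's `BHK2006.core` (BHK Thm 1.1, induction on the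
vertex set with the Ahlswede–Daykin four functions theorem) with the G-slot carrying the forced-opened cluster; base case by three Harris
inequalities and the pointwise domination `Ĉ_Y ⊆ C(ω ∪ e)`; inductive step by `QuantBHK.step_sum_hat` and antitonicity in the avoided set;
the degenerate cases (e meets `Z = X ∩ Y`) are `BHK2006.core` itself.  `QuantBHK.forcedOpening_sum` = the case `U = univ`, `X = Y` (FO).
No definitions, no named facts, no sorries; standard axioms.
[cite: VandenbergHaggstromKahn2005, Thm. 1.1 (pp. 3–5), display (4) (p. 4)]
-/

noncomputable section

open MeasureTheory
open Literature.Probability.LatticeModels (prodBernoulli)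

namespace Summit.CriticalPhenomena.PercolationContinuityZ3.Theorems

namespace QuantBHK

open Literature.Probability.Percolation Literature.Probability.Percolation.BHK2006
open scoped Classical
open DecisionTree (ind ind_of_mem ind_of_not_mem ind_nonneg)

section Hat

variable {V : Type*} [Fintype V]

/-! ### (TP): Theorem 1.1 with the forced-opened pair in the `G`-slot -/

/-- **(TP)** — BHK's Theorem 1.1 (functional form, restricted to `U`) with the second cluster forced-opened at `e`:
for `s ∈ U`, `X, Y ⊆ U`, `F, G ≥ 0` increasing,
`E[F(C) 1{s↮X}] · E[G(Ĉ_Y) 1{s↮Y}] ≤ E[F(C) G(Ĉ_{X∩Y}) 1{s ↮ X∩Y}] · P(s ↮ X∪Y)`.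
Proof: BHK's induction on `U` (tree `core`) with the marked changes of PROOFS §P12. [cite: VandenbergHaggstromKahn2005, Thm. 1.1 (pp. 3–5), Thm. 1.3 (p. 6)] -/
theorem coreHat (w : Sym2 V → ℝ) (hw0 : ∀ e, 0 ≤ w e) (hw1 : ∀ e, w e ≤ 1)
    (hm : ∑ ω, weight w ω = 1) (e : Sym2 V) (U : Finset V) :
    ∀ (s : V), s ∈ U → ∀ (X Y : Set V), X ⊆ ↑U → Y ⊆ ↑U →
    ∀ (F G : Set (Sym2 V) → ℝ), Monotone F → Monotone G → (∀ a, 0 ≤ F a) → (∀ a, 0 ≤ G a) →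
    (∑ ω, weight w ω * (F (rC U s ω) * ind (rD U s X) ω)) *
      (∑ ω, weight w ω * (G (rCHat U s Y e ω) * ind (rD U s Y) ω)) ≤
    (∑ ω, weight w ω * (F (rC U s ω) * G (rCHat U s (X ∩ Y) e ω) * ind (rD U s (X ∩ Y)) ω)) *
      (∑ ω, weight w ω * ind (rD U s (X ∪ Y)) ω) := by
  induction U using Finset.strongInduction with
  | H U ih =>
  intro s hsU X Y hXU hYU F G hF hG hF0 hG0
  have hRHS : 0 ≤ (∑ ω, weight w ω * (F (rC U s ω) * G (rCHat U s (X ∩ Y) e ω) * ind (rD U s (X ∩ Y)) ω)) *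
      (∑ ω, weight w ω * ind (rD U s (X ∪ Y)) ω) :=
    mul_nonneg (Finset.sum_nonneg fun ω _ => mul_nonneg (weight_nonneg hw0 hw1 ω)
      (mul_nonneg (mul_nonneg (hF0 _) (hG0 _)) (ind_nonneg _ _)))
      (Finset.sum_nonneg fun ω _ => mul_nonneg (weight_nonneg hw0 hw1 ω) (ind_nonneg _ _))
  -- trivial cases `s ∈ X`, `s ∈ Y`
  by_cases hsX : s ∈ X
  · have h0 : ∑ ω, weight w ω * (F (rC U s ω) * ind (rD U s X) ω) = 0 :=
      Finset.sum_eq_zero fun ω _ => by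
        rw [rD_eq_empty hsX, ind_of_not_mem (Set.notMem_empty ω)]; ring
    rw [h0, zero_mul]; exact hRHS
  by_cases hsY : s ∈ Y
  · have h0 : ∑ ω, weight w ω * (G (rCHat U s Y e ω) * ind (rD U s Y) ω) = 0 :=
      Finset.sum_eq_zero fun ω _ => by
        rw [rD_eq_empty hsY, ind_of_not_mem (Set.notMem_empty ω)]; ring
    rw [h0, mul_zero]; exact hRHS
  -- `Z := X ∩ Y`
  set Z : Finset V := U.filter fun v => v ∈ X ∧ v ∈ Y with hZ
  have hZU : Z ⊆ U := Finset.filter_subset _ _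
  have hmemZ : ∀ v, v ∈ Z ↔ v ∈ X ∧ v ∈ Y := fun v => by
    simp only [hZ, Finset.mem_filter, and_iff_right_iff_imp]
    exact fun h => hXU h.1
  have hsZ : s ∉ Z := fun h => hsX ((hmemZ s).1 h).1
  rcases Z.eq_empty_or_nonempty with hZe | hZne
  · /- `X ∩ Y = ∅`: Harris thrice, with `G(Ĉ_Y) ≤ G(C(ω ∪ e))` (★ base case). -/
    have hXY : ∀ ω, ind (rD U s (X ∩ Y)) ω = 1 := fun ω =>
      ind_of_mem fun x hx _ => by
        have : x ∈ Z := (hmemZ x).2 hx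
        rw [hZe] at this
        exact absurd this (Finset.notMem_empty x)
    have hmemXY : ∀ ω, ω ∈ rD U s (X ∩ Y) := fun ω x hx _ => by
      have : x ∈ Z := (hmemZ x).2 hx
      rw [hZe] at this
      exact absurd this (Finset.notMem_empty x)
    have hhat : ∀ ω, rCHat U s (X ∩ Y) e ω = rC U s (insert e ω) := fun ω =>
      rCHat_eq_insert_of_mem (hmemXY (insert e ω))
    have hXuY : ∀ ω, ind (rD U s (X ∪ Y)) ω = ind (rD U s X) ω * ind (rD U s Y) ω := fun ω => by
      rw [rD_union, ind_inter]
    simp_rw [hXY, mul_one, hXuY, hhat]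
    set Gp : Set (Sym2 V) → ℝ := fun ω => G (rC U s (insert e ω)) with hGp
    have hFm : Monotone fun ω => F (rC U s ω) := fun a b hab => hF (rC_mono U s hab)
    have hGpm : Monotone Gp := fun a b hab => hG (rC_mono U s (Set.insert_subset_insert hab))
    have hGp0 : ∀ a, 0 ≤ Gp a := fun a => hG0 _
    -- `E[G(Ĉ_Y) 1_Y] ≤ E[G(C⁺) 1_Y]`
    have h0 : ∑ ω, weight w ω * (G (rCHat U s Y e ω) * ind (rD U s Y) ω) ≤
        ∑ ω, weight w ω * (Gp ω * ind (rD U s Y) ω) :=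
      Finset.sum_le_sum fun ω _ => mul_le_mul_of_nonneg_left
        (mul_le_mul_of_nonneg_right (hG (rCHat_subset_insert U s Y e ω)) (ind_nonneg _ _)) (weight_nonneg hw0 hw1 ω)
    have h1 : ∑ ω, weight w ω * (F (rC U s ω) * ind (rD U s X) ω) ≤
        (∑ ω, weight w ω * F (rC U s ω)) * ∑ ω, weight w ω * ind (rD U s X) ω :=
      harris_mono_anti hw0 hw1 hm (fun _ => hF0 _) hFm
        (ind_rD_antitone U s X) (fun _ => ind_le_one _ _)
    have h2 : ∑ ω, weight w ω * (Gp ω * ind (rD U s Y) ω) ≤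
        (∑ ω, weight w ω * Gp ω) * ∑ ω, weight w ω * ind (rD U s Y) ω :=
      harris_mono_anti hw0 hw1 hm hGp0 hGpm
        (ind_rD_antitone U s Y) (fun _ => ind_le_one _ _)
    have h3 : (∑ ω, weight w ω * F (rC U s ω)) * (∑ ω, weight w ω * Gp ω) ≤
        ∑ ω, weight w ω * (F (rC U s ω) * Gp ω) := by
      have := harris hw0 hw1 (fun _ => hF0 _) hGp0 hFm hGpm
      rwa [hm, one_mul] at this
    have h4 : (∑ ω, weight w ω * ind (rD U s X) ω) * (∑ ω, weight w ω * ind (rD U s Y) ω) ≤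
        ∑ ω, weight w ω * (ind (rD U s X) ω * ind (rD U s Y) ω) :=
      harris_anti_anti hw0 hw1 hm
        (ind_rD_antitone U s X) (ind_rD_antitone U s Y) (fun _ => ind_le_one _ _)
        (fun _ => ind_le_one _ _)
    have hFn : 0 ≤ ∑ ω, weight w ω * F (rC U s ω) :=
      Finset.sum_nonneg fun ω _ => mul_nonneg (weight_nonneg hw0 hw1 ω) (hF0 _)
    have hGn : 0 ≤ ∑ ω, weight w ω * Gp ω :=
      Finset.sum_nonneg fun ω _ => mul_nonneg (weight_nonneg hw0 hw1 ω) (hGp0 _)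
    have hXn : 0 ≤ ∑ ω, weight w ω * ind (rD U s X) ω :=
      Finset.sum_nonneg fun ω _ => mul_nonneg (weight_nonneg hw0 hw1 ω) (ind_nonneg _ _)
    have hYn : 0 ≤ ∑ ω, weight w ω * ind (rD U s Y) ω :=
      Finset.sum_nonneg fun ω _ => mul_nonneg (weight_nonneg hw0 hw1 ω) (ind_nonneg _ _)
    have hGYn : 0 ≤ ∑ ω, weight w ω * (G (rCHat U s Y e ω) * ind (rD U s Y) ω) :=
      sum_ind_nonneg hw0 hw1 (fun _ => hG0 _) _
    calc (∑ ω, weight w ω * (F (rC U s ω) * ind (rD U s X) ω)) *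
          (∑ ω, weight w ω * (G (rCHat U s Y e ω) * ind (rD U s Y) ω))
        ≤ (∑ ω, weight w ω * (F (rC U s ω) * ind (rD U s X) ω)) *
          (∑ ω, weight w ω * (Gp ω * ind (rD U s Y) ω)) :=
          mul_le_mul_of_nonneg_left h0 (sum_ind_nonneg hw0 hw1 (fun _ => hF0 _) _)
      _ ≤ ((∑ ω, weight w ω * F (rC U s ω)) * ∑ ω, weight w ω * ind (rD U s X) ω) *
          ((∑ ω, weight w ω * Gp ω) * ∑ ω, weight w ω * ind (rD U s Y) ω) :=
          mul_le_mul h1 h2 (sum_ind_nonneg hw0 hw1 hGp0 _) (mul_nonneg hFn hXn)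
      _ = ((∑ ω, weight w ω * F (rC U s ω)) * ∑ ω, weight w ω * Gp ω) *
          ((∑ ω, weight w ω * ind (rD U s X) ω) * ∑ ω, weight w ω * ind (rD U s Y) ω) := by ring
      _ ≤ (∑ ω, weight w ω * (F (rC U s ω) * Gp ω)) *
          ∑ ω, weight w ω * (ind (rD U s X) ω * ind (rD U s Y) ω) :=
          mul_le_mul h3 h4 (mul_nonneg hXn hYn)
            (Finset.sum_nonneg fun ω _ => mul_nonneg (weight_nonneg hw0 hw1 ω) (mul_nonneg (hF0 _) (hGp0 _)))
  · /- `Z ≠ ∅` -/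
    have hss : U \ Z ⊂ U := Finset.sdiff_ssubset hZU hZne
    have hsU' : s ∈ U \ Z := Finset.mem_sdiff.2 ⟨hsU, hsZ⟩
    have hZX : (↑Z : Set V) ⊆ X := fun v hv => ((hmemZ v).1 hv).1
    have hZY : (↑Z : Set V) ⊆ Y := fun v hv => ((hmemZ v).1 hv).2
    have hZXY : (↑Z : Set V) ⊆ X ∩ Y := fun v hv => (hmemZ v).1 hv
    have hZXuY : (↑Z : Set V) ⊆ X ∪ Y := fun v hv => Or.inl (((hmemZ v).1 hv).1)
    by_cases hdeg : e ∈ meeting Z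
    · /- ★ degenerate: the hats are the clusters; this is BHK's Theorem 1.1 (`core`). -/
      have hY' : ∀ ω, rCHat U s Y e ω = rC U s ω := fun ω => rCHat_eq_rC_of_degenerate hZY (Or.inl hdeg) ω
      have hXY' : ∀ ω, rCHat U s (X ∩ Y) e ω = rC U s ω := fun ω => rCHat_eq_rC_of_degenerate hZXY (Or.inl hdeg) ω
      simp_rw [hY', hXY']
      exact core w hw0 hw1 hm U s hsU X Y hXU hYU F G hF hG hF0 hG0
    · /- ★ generic: condition on `S` with the hatted blocks and apply the four functions theorem. -/
      have hFG0 : ∀ a b, 0 ≤ F a * G b := fun a b => mul_nonneg (hF0 a) (hG0 b)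
      have e1 := step_sum hZU hsZ hZX w hm F
      have e2 : ∑ ω, weight w ω * (G (rCHat U s Y e ω) * ind (rD U s Y) ω) =
          ∑ ω, weight w ω * blockEHat w (U \ Z) s (fun _ => 1) G e (Y \ ↑Z) (rS U Z ω) := by
        have := step_sum_hat hZU hsZ hZY w hm (fun _ => (1 : ℝ)) G hdeg
        simpa only [one_mul] using this
      have e3 : ∑ ω, weight w ω * (F (rC U s ω) * G (rCHat U s (X ∩ Y) e ω) * ind (rD U s (X ∩ Y)) ω) =
          ∑ ω, weight w ω * blockEHat w (U \ Z) s F G e ((X ∩ Y) \ ↑Z) (rS U Z ω) :=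
        step_sum_hat hZU hsZ hZXY w hm F G hdeg
      have e4 : ∑ ω, weight w ω * ind (rD U s (X ∪ Y)) ω =
          ∑ ω, weight w ω * blockE w (U \ Z) s (fun _ => 1) ((X ∪ Y) \ ↑Z) (rS U Z ω) := by
        have := step_sum hZU hsZ hZXuY w hm (fun _ => 1)
        simpa only [one_mul] using this
      rw [e1, e2, e3, e4]
      refine four_functions_theorem_univ
        (fun ω => weight w ω * blockE w (U \ Z) s F (X \ ↑Z) (rS U Z ω))
        (fun ω => weight w ω * blockEHat w (U \ Z) s (fun _ => 1) G e (Y \ ↑Z) (rS U Z ω))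
        (fun ω => weight w ω * blockEHat w (U \ Z) s F G e ((X ∩ Y) \ ↑Z) (rS U Z ω))
        (fun ω => weight w ω * blockE w (U \ Z) s (fun _ => 1) ((X ∪ Y) \ ↑Z) (rS U Z ω))
        (fun ω => mul_nonneg (weight_nonneg hw0 hw1 ω) (blockE_nonneg hw0 hw1 _ _ hF0 _ _))
        (fun ω => mul_nonneg (weight_nonneg hw0 hw1 ω) (blockEHat_nonneg hw0 hw1 _ _ (fun _ => zero_le_one) hG0 _ _ _))
        (fun ω => mul_nonneg (weight_nonneg hw0 hw1 ω) (blockEHat_nonneg hw0 hw1 _ _ hF0 hG0 _ _ _))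
        (fun ω => mul_nonneg (weight_nonneg hw0 hw1 ω)
          (blockE_nonneg hw0 hw1 _ _ (fun _ => zero_le_one) _ _))
        fun a b => ?_
      set Sa := rS U Z a with hSa
      set Sb := rS U Z b with hSb
      have hSaU : Sa ⊆ ↑(U \ Z) := rS_subset U Z a
      have hSbU : Sb ⊆ ↑(U \ Z) := rS_subset U Z b
      have hX1 : X \ ↑Z ∪ Sa ⊆ ↑(U \ Z) := Set.union_subset
        (fun v hv => by rw [Finset.coe_sdiff]; exact ⟨hXU hv.1, hv.2⟩) hSaU
      have hY1 : Y \ ↑Z ∪ Sb ⊆ ↑(U \ Z) := Set.union_subset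
        (fun v hv => by rw [Finset.coe_sdiff]; exact ⟨hYU hv.1, hv.2⟩) hSbU
      have IH := ih (U \ Z) hss s hsU' (X \ ↑Z ∪ Sa) (Y \ ↑Z ∪ Sb) hX1 hY1 F G hF hG hF0 hG0
      have hsub3 : (X ∩ Y) \ ↑Z ∪ rS U Z (a ∩ b) ⊆ (X \ ↑Z ∪ Sa) ∩ (Y \ ↑Z ∪ Sb) := by
        refine Set.union_subset (fun v hv => ⟨Or.inl ⟨hv.1.1, hv.2⟩, Or.inl ⟨hv.1.2, hv.2⟩⟩) ?_
        exact fun v hv =>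
          ⟨Or.inr (rS_inter_subset U Z a b hv).1, Or.inr (rS_inter_subset U Z a b hv).2⟩
      have hsub4 : (X ∪ Y) \ ↑Z ∪ rS U Z (a ∪ b) ⊆ (X \ ↑Z ∪ Sa) ∪ (Y \ ↑Z ∪ Sb) := by
        rw [rS_union]
        rintro v (⟨hXY | hXY, hvZ⟩ | hS | hS)
        · exact Or.inl (Or.inl ⟨hXY, hvZ⟩)
        · exact Or.inr (Or.inl ⟨hXY, hvZ⟩)
        · exact Or.inl (Or.inr hS)
        · exact Or.inr (Or.inr hS)
      -- ★ antitonicity of the hatted joint term in the avoided set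
      have h3 : ∑ ω, weight w ω * (F (rC (U \ Z) s ω) * G (rCHat (U \ Z) s ((X \ ↑Z ∪ Sa) ∩ (Y \ ↑Z ∪ Sb)) e ω) *
          ind (rD (U \ Z) s ((X \ ↑Z ∪ Sa) ∩ (Y \ ↑Z ∪ Sb))) ω) ≤
          blockEHat w (U \ Z) s F G e ((X ∩ Y) \ ↑Z) (rS U Z (a ∩ b)) := by
        unfold blockEHat
        refine Finset.sum_le_sum fun ω _ => mul_le_mul_of_nonneg_left ?_ (weight_nonneg hw0 hw1 ω)
        refine mul_le_mul (mul_le_mul_of_nonneg_left (hG (rCHat_antitone hsub3 e ω)) (hF0 _))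
          (ind_mono (rD_antitone hsub3) ω) (ind_nonneg _ _) (hFG0 _ _)
      have h4 : ∑ ω, weight w ω * ind (rD (U \ Z) s ((X \ ↑Z ∪ Sa) ∪ (Y \ ↑Z ∪ Sb))) ω ≤
          blockE w (U \ Z) s (fun _ => 1) ((X ∪ Y) \ ↑Z) (rS U Z (a ∪ b)) := by
        have := sum_ind_mono hw0 hw1 (h := fun _ => (1 : ℝ)) (fun _ => zero_le_one)
          (rD_antitone (U := U \ Z) (s := s) hsub4) (w := w)
        simp only [one_mul] at this
        simpa only [blockE, one_mul] using this
      have hn3 : 0 ≤ ∑ ω, weight w ω * (F (rC (U \ Z) s ω) * G (rCHat (U \ Z) s ((X \ ↑Z ∪ Sa) ∩ (Y \ ↑Z ∪ Sb)) e ω) *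
          ind (rD (U \ Z) s ((X \ ↑Z ∪ Sa) ∩ (Y \ ↑Z ∪ Sb))) ω) :=
        Finset.sum_nonneg fun ω _ => mul_nonneg (weight_nonneg hw0 hw1 ω)
          (mul_nonneg (hFG0 _ _) (ind_nonneg _ _))
      have hIH' : blockE w (U \ Z) s F (X \ ↑Z) Sa * blockEHat w (U \ Z) s (fun _ => 1) G e (Y \ ↑Z) Sb ≤
          blockEHat w (U \ Z) s F G e ((X ∩ Y) \ ↑Z) (rS U Z (a ∩ b)) *
            blockE w (U \ Z) s (fun _ => 1) ((X ∪ Y) \ ↑Z) (rS U Z (a ∪ b)) := by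
        have hL : blockE w (U \ Z) s F (X \ ↑Z) Sa * blockEHat w (U \ Z) s (fun _ => 1) G e (Y \ ↑Z) Sb =
            (∑ ω, weight w ω * (F (rC (U \ Z) s ω) * ind (rD (U \ Z) s (X \ ↑Z ∪ Sa)) ω)) *
            (∑ ω, weight w ω * (G (rCHat (U \ Z) s (Y \ ↑Z ∪ Sb) e ω) * ind (rD (U \ Z) s (Y \ ↑Z ∪ Sb)) ω)) := by
          simp only [blockE, blockEHat, one_mul]
        rw [hL]
        exact IH.trans (mul_le_mul h3 h4 (Finset.sum_nonneg fun ω _ =>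
          mul_nonneg (weight_nonneg hw0 hw1 ω) (ind_nonneg _ _))
          (blockEHat_nonneg hw0 hw1 _ _ hF0 hG0 _ _ _))
      have hwab := weight_inter_mul_union w a b
      show weight w a * blockE w (U \ Z) s F (X \ ↑Z) Sa *
          (weight w b * blockEHat w (U \ Z) s (fun _ => 1) G e (Y \ ↑Z) Sb) ≤
        weight w (a ∩ b) * blockEHat w (U \ Z) s F G e ((X ∩ Y) \ ↑Z) (rS U Z (a ∩ b)) *
          (weight w (a ∪ b) * blockE w (U \ Z) s (fun _ => 1) ((X ∪ Y) \ ↑Z) (rS U Z (a ∪ b)))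
      calc weight w a * blockE w (U \ Z) s F (X \ ↑Z) Sa *
            (weight w b * blockEHat w (U \ Z) s (fun _ => 1) G e (Y \ ↑Z) Sb)
          = (weight w a * weight w b) *
            (blockE w (U \ Z) s F (X \ ↑Z) Sa * blockEHat w (U \ Z) s (fun _ => 1) G e (Y \ ↑Z) Sb) := by ring
        _ ≤ (weight w (a ∩ b) * weight w (a ∪ b)) *
            (blockEHat w (U \ Z) s F G e ((X ∩ Y) \ ↑Z) (rS U Z (a ∩ b)) *
              blockE w (U \ Z) s (fun _ => 1) ((X ∪ Y) \ ↑Z) (rS U Z (a ∪ b))) := by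
            rw [hwab]
            exact mul_le_mul_of_nonneg_left hIH'
              (mul_nonneg (weight_nonneg hw0 hw1 _) (weight_nonneg hw0 hw1 _))
        _ = _ := by ring

end Hat

section Glauber

variable {V : Type*} [Fintype V]

/-- **(FO), sum form**: for `D = {s ↮ X}`, `F, G ≥ 0` increasing and any pair `e`,
`(Σ w·F(C)1_D)(Σ w·G(Ĉ_X)1_D) ≤ (Σ w·F(C)G(Ĉ_X)1_D)(Σ w·1_D)` — `coreHat` at `U = univ`, `X = Y`. [cite: VandenbergHaggstromKahn2005, Thm. 1.1 (pp. 3–5), Thm. 1.3 (p. 6)] -/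
theorem forcedOpening_sum (w : Sym2 V → ℝ) (hw0 : ∀ e, 0 ≤ w e) (hw1 : ∀ e, w e ≤ 1)
    (hm : ∑ ω, weight w ω = 1) (e : Sym2 V) (s : V) (X : Set V)
    (F G : Set (Sym2 V) → ℝ) (hF : Monotone F) (hG : Monotone G) (hF0 : ∀ a, 0 ≤ F a) (hG0 : ∀ a, 0 ≤ G a) :
    (∑ ω, weight w ω * (F (rC Finset.univ s ω) * ind (rD Finset.univ s X) ω)) *
      (∑ ω, weight w ω * (G (rCHat Finset.univ s X e ω) * ind (rD Finset.univ s X) ω)) ≤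
    (∑ ω, weight w ω * (F (rC Finset.univ s ω) * G (rCHat Finset.univ s X e ω) * ind (rD Finset.univ s X) ω)) *
      (∑ ω, weight w ω * ind (rD Finset.univ s X) ω) := by
  have h := coreHat w hw0 hw1 hm e Finset.univ s (Finset.mem_univ s) X X (by simp) (by simp) F G hF hG hF0 hG0
  rw [Set.inter_self, Set.union_self] at h
  exact h

end Glauber

end QuantBHK

end Summit.CriticalPhenomena.PercolationContinuityZ3.Theorems
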